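import Mathlib
import HarnessLib
import Summits.NavierStokesRegularity.NavierStokesRegularity.Theorems.RellichScarScarRigidityApexRegularity
import Summits.NavierStokesRegularity.NavierStokesRegularity.Theorems.RellichScarSymmetricScarExistsApexRieszPressureBounds
import Summits.NavierStokesRegularity.NavierStokesRegularity.Theorems.LocalPressureProfileDoorMonotonePressureProfileRigiditySmallSliceDini
import Summits.NavierStokesRegularity.NavierStokesRegularity.Theorems.LocalPressureProfileDoorMonotonePressureProfileRigiditySmallSlicePairings

/-!
# Route `LocalPressureProfileDoor`, crux K2⁺ `MonotonePressureProfileRigidity` (stmt-NavierStokesRegularity-20180),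
# line `birth`, stub `stub_smallSliceOfMonotonePressure` — helper 4c: THE DISSIPATION BUDGET
# `∫_{t₁}^{t₂} (−t) ∫ ‖curl v(t)‖² G(t) dx dt ≤ 2 (sup|q_E| + sup|(−t)p|)`

Cell ns-regularity-ideate, seat ns-pressure-K2-p1 (LEAD; helper file, lands `--supports stmt-NavierStokesRegularity-20180`).

This is the line's "eternal head-pressure budget against the adjoint weight", in physical variables, with the ADAPTED BACKWARD
KERNEL AT THE APEX as the weight and WITHOUT any time derivative of the pressure.  For a profile `v` of the Type-I ancient mild
class with the space–time Type-I bound, whose similarity Riesz pressure is shift-monotone (the K2⁺ hypothesis), and an apex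
kernel `G` (helper 1):

* `A(t) = ∫ q_E(t) G(t)` (head field, helper 2) has `A′ = a′`;  `Φ_τ(t) = ∫ q_τ(t) G(t)` (frozen slice, helper 3) has
  `∂ₜΦ_τ(τ) = γ(τ)`; `a′ + γ = −(−t) H`, `H(t) = ∫ ‖curl v(t)‖² G(t)` (helper 4b);
* MONOTONICITY: `τ ↦ Φ_τ(t)` is non-increasing (helper 3, `frozen_le_frozen`), so the diagonal `D(t) = Φ_t(t) = ∫ (−t)p(t)G(t)`
  satisfies `D(u) − D(t) ≤ Φ_t(u) − Φ_t(t)` for `u > t`: its upper right Dini derivative is `≤ γ(t)`, and the Dini form of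
  FTC-2 (helper 4a) gives `D(t₂) − D(t₁) ≤ ∫_{t₁}^{t₂} γ`;
* `A(t₂) − A(t₁) = ∫ a′` (FTC), hence `∫_{t₁}^{t₂} (−t)H = −∫(a′ + γ) ≤ |A(t₁)| + |A(t₂)| + |D(t₁)| + |D(t₂)| ≤ 2(M_E + M_P)` with
  `M_E = ½D² + ½D` (`abs_headField_le`) and `M_P = K` (`abs_neg_mul_pressure_le`), UNIFORMLY in the window `−1 < t₁ ≤ t₂ < 0`.

`dissipation_budget` states exactly this (with the interval integrability of `(−t)H(t)`).

WHAT THIS IS NOT: not a claim about Navier–Stokes regularity; the budget of the L stub of a conditional door crux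
(bears_on LADDER-NS N0, rung N0-LocalTubeDoorPressureProfile).
-/

noncomputable section

set_option linter.dupNamespace false -- the summit and its sub-problem share the name (CONVENTIONS §1)
set_option maxSynthPendingDepth 3 -- nested operator types `ℝ³ →L[ℝ] ℝ³ →L[ℝ] ℝ³`

namespace Summit.NavierStokesRegularity.NavierStokesRegularity.Theorems.LocalPressureProfileDoorMonotonePressureProfileRigiditySmallSliceBudget

open MeasureTheory Set Function Filter Metric Topology InnerProductSpace intervalIntegral
open scoped ENNReal NNReal InnerProductSpace RealInnerProductSpace Laplacian ContDiff
open Literature.Analysis Literature.Analysis.FluidPDE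
open Summit.NavierStokesRegularity.NavierStokesRegularity.Theorems.RellichScarScarRigidity
  (exists_isClassicalNSSolutionOn_Iio isClassicalNSSolutionOn_rieszPressure exists_norm_iteratedFDeriv_le_apex
    exists_norm_deriv_le_apex)
open Summit.NavierStokesRegularity.NavierStokesRegularity.Theorems.SymmetricScarExists.LogtimeBernoulli
  (apexRieszPressure_scaleInvariantBounds)
open Summit.NavierStokesRegularity.NavierStokesRegularity.Theorems.LocalPressureProfileDoorMonotonePressureProfileRigiditySmallSliceKernel
open Summit.NavierStokesRegularity.NavierStokesRegularity.Theorems.LocalPressureProfileDoorMonotonePressureProfileRigiditySmallSliceHead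
open Summit.NavierStokesRegularity.NavierStokesRegularity.Theorems.LocalPressureProfileDoorMonotonePressureProfileRigiditySmallSliceFrozen
open Summit.NavierStokesRegularity.NavierStokesRegularity.Theorems.LocalPressureProfileDoorMonotonePressureProfileRigiditySmallSliceDini
open Summit.NavierStokesRegularity.NavierStokesRegularity.Theorems.LocalPressureProfileDoorMonotonePressureProfileRigiditySmallSlicePairings

/-! ### Class bounds in the shape used by the helpers -/

/-- **The scale-invariant apex bounds of a Type-I ancient mild profile**, packaged with ONE constant `L ≥ 0`:
`‖Dv‖ ≤ L/(‖x‖+√(−t))²`, `‖D²v‖, ‖∂ₜv‖ ≤ L/(‖x‖+√(−t))³` (tree `exists_norm_iteratedFDeriv_le_apex`, `exists_norm_deriv_le_apex`).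
[cite: KochNadirashviliSereginSverak2009, Prop. 4.1 (arXiv:0709.3599v1 p. 8)] -/
theorem apex_bounds {D : ℝ} {v : ℝ → EuclideanSpace ℝ (Fin 3) → EuclideanSpace ℝ (Fin 3)}
    {p : ℝ → EuclideanSpace ℝ (Fin 3) → ℝ} (hA : IsTypeIAncientMild D v) (hdec : HasTypeIDecay D v)
    (hcl : IsClassicalNSSolutionOn (Iio (0 : ℝ)) 1 0 v p) :
    ∃ L : ℝ, 0 ≤ L ∧
      (∀ t < (0 : ℝ), ∀ x : EuclideanSpace ℝ (Fin 3), ‖fderiv ℝ (v t) x‖ ≤ L / (‖x‖ + Real.sqrt (-t)) ^ 2) ∧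
      (∀ t < (0 : ℝ), ∀ x : EuclideanSpace ℝ (Fin 3), ‖iteratedFDeriv ℝ 2 (v t) x‖ ≤ L / (‖x‖ + Real.sqrt (-t)) ^ 3) ∧
      (∀ t < (0 : ℝ), ∀ x : EuclideanSpace ℝ (Fin 3), ‖deriv (fun s => v s x) t‖ ≤ L / (‖x‖ + Real.sqrt (-t)) ^ 3) := by
  obtain ⟨L₁, hL₁0, hL₁⟩ := exists_norm_iteratedFDeriv_le_apex D
  obtain ⟨L₂, hL₂0, hL₂⟩ := exists_norm_deriv_le_apex D
  refine ⟨L₁ + L₂, by positivity, fun t ht x => ?_, fun t ht x => ?_, fun t ht x => ?_⟩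
  · have h := hL₁ hA hdec 1 (by norm_num) t ht x
    rw [norm_iteratedFDeriv_one] at h
    exact h.trans (div_le_div_of_nonneg_right (by linarith) (by positivity))
  · exact (hL₁ hA hdec 2 (by norm_num) t ht x).trans (div_le_div_of_nonneg_right (by linarith) (by positivity))
  · exact (hL₂ hA hdec hcl t ht x).trans (div_le_div_of_nonneg_right (by linarith) (by positivity))

/-! ### The budget -/

set_option maxHeartbeats 1600000 in
/-- **THE DISSIPATION BUDGET.**  Let `v` be a Type-I ancient mild profile (`IsTypeIAncientMild D v`) with the space–time Type-I
bound `HasTypeIDecay D v` whose similarity Riesz pressure is shift-monotone —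
`(−e^{−σ}t) Q[v(e^{−σ}t)](√(−e^{−σ}t) y) ≤ (−t) Q[v(t)](√(−t) y)` for `t < 0`, `σ ∈ [0,1]`, `y` — and let `G` be an adapted
backward kernel of `∂ₜ + v·∇ − Δ` on `[−1,0)` with pole `(0,0)` and an upper Gaussian bound.  Then there is `M` such that for
every window `−1 < t₁ ≤ t₂ < 0` the kernel-weighted enstrophy `H(t) = ∫ ‖curl v(t)‖² G(t)` satisfies
`∫_{t₁}^{t₂} (−t) H(t) dt ≤ M` (and `(−t)H(t)` is integrable on the window).  See the module docstring for the proof.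
[cite: Tsai1998, (1.7) and §5] -/
theorem dissipation_budget {D : ℝ} {v : ℝ → EuclideanSpace ℝ (Fin 3) → EuclideanSpace ℝ (Fin 3)}
    (hA : IsTypeIAncientMild D v) (hdec : HasTypeIDecay D v)
    (hmono : ∀ t < (0 : ℝ), ∀ σ ∈ Icc (0 : ℝ) 1, ∀ y : EuclideanSpace ℝ (Fin 3),
      (-(Real.exp (-σ) * t)) * pressurePotential (v (Real.exp (-σ) * t)) (Real.sqrt (-(Real.exp (-σ) * t)) • y) ≤
        (-t) * pressurePotential (v t) (Real.sqrt (-t) • y))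
    {G : ℝ → EuclideanSpace ℝ (Fin 3) → ℝ} (hK : IsAdaptedBackwardKernel 1 v (Ico (-1 : ℝ) 0) 0 0 G)
    {C₁ C₂ : ℝ} (hC₁ : 0 ≤ C₁) (hC₂ : 0 < C₂)
    (hup : ∀ t ∈ Ico (-1 : ℝ) 0, ∀ x : EuclideanSpace ℝ (Fin 3),
      G t x ≤ C₁ * (-t) ^ (-(3 : ℝ) / 2) * Real.exp (-(‖x‖ ^ 2) / (C₂ * (-t)))) :
    ∃ M : ℝ, ∀ t₁ t₂ : ℝ, -1 < t₁ → t₁ ≤ t₂ → t₂ < 0 →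
      IntervalIntegrable (fun t => (-t) * ∫ x, ‖curl (v t) x‖ ^ 2 * G t x) volume t₁ t₂ ∧
      ∫ t in t₁..t₂, (-t) * ∫ x, ‖curl (v t) x‖ ^ 2 * G t x ≤ M := by
  have hD0 : 0 ≤ D := hA.nonneg
  -- the Riesz pressure is a classical pressure
  obtain ⟨q, hq⟩ := exists_isClassicalNSSolutionOn_Iio hA
  have hcl : IsClassicalNSSolutionOn (Iio (0 : ℝ)) 1 0 v (fun t x => pressurePotential (v t) x) :=
    isClassicalNSSolutionOn_rieszPressure hq hdec
  set p : ℝ → EuclideanSpace ℝ (Fin 3) → ℝ := fun t x => pressurePotential (v t) x with hp_def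
  -- class bounds
  obtain ⟨L, hL0, h1, h2, h3⟩ := apex_bounds hA hdec hcl
  have h0 : ∀ t < (0 : ℝ), ∀ x : EuclideanSpace ℝ (Fin 3), ‖v t x‖ ≤ D / (‖x‖ + Real.sqrt (-t)) := fun t ht x => hdec t ht x
  obtain ⟨Kp, hKp0, hKp⟩ := apexRieszPressure_scaleInvariantBounds D
  have hKp' : ∀ t < (0 : ℝ), ∀ z : EuclideanSpace ℝ (Fin 3), (‖z‖ + Real.sqrt (-t)) ^ 2 * |p t z| ≤ Kp ∧
      (‖z‖ + Real.sqrt (-t)) ^ 3 * ‖fderiv ℝ (p t) z‖ ≤ Kp ∧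
      (‖z‖ + Real.sqrt (-t)) ^ 4 * ‖iteratedFDeriv ℝ 2 (p t) z‖ ≤ Kp := fun t ht z => hKp v q hq hdec t ht z
  -- the constant
  set ME : ℝ := 1 / 2 * D ^ 2 + 1 / 2 * D with hME_def
  refine ⟨2 * ME + 2 * Kp, fun t₁ t₂ ht₁ ht₁₂ ht₂ => ?_⟩
  -- the window
  set b : ℝ := t₂ / 2 with hb_def
  have hb : b < 0 := by rw [hb_def]; linarith
  have ht₂b : t₂ < b := by rw [hb_def]; linarith
  set S : Set ℝ := Ioo (-1 : ℝ) b with hS_def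
  have hS : IsOpen S := isOpen_Ioo
  have hSI : S ⊆ Iio (0 : ℝ) := fun s hs => lt_trans hs.2 hb
  have hSK : S ⊆ Ico (-1 : ℝ) 0 := fun s hs => ⟨hs.1.le, hSI hs⟩
  have hIS : Icc t₁ t₂ ⊆ S := fun s hs => ⟨lt_of_lt_of_le ht₁ hs.1, lt_of_le_of_lt hs.2 ht₂b⟩
  -- the head pairing
  set qE : ℝ → EuclideanSpace ℝ (Fin 3) → ℝ := fun t x => (-t) / 2 * ‖v t x‖ ^ 2 + 1 / 2 * ⟪x, v t x⟫ with hqE_def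
  have hqE : ∀ t x, qE t x = (-t) / 2 * ‖v t x‖ ^ 2 + 1 / 2 * ⟪x, v t x⟫ := fun t x => rfl
  set A : ℝ → ℝ := fun t => ∫ x, qE t x * G t x with hA_def
  set a' : ℝ → ℝ := fun t => ∫ x, (timeDerivWithin S qE t x + fderiv ℝ (qE t) x (v t x) - (Δ (qE t)) x) * G t x
    with ha'_def
  obtain ⟨hA', ha'cont⟩ := hasDerivAt_headPairing hA hcl hK hC₁ hC₂ hup hb hD0 hL0 h0 h1 h2 h3 hqE
  obtain ⟨MEw, hMEw⟩ := headField_window_bounds hcl isOpen_Iio hqE hD0 hL0 le_rfl hb hSI h0 h1 h2 h3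
  -- the frozen pairings
  set Q : ℝ → ℝ → EuclideanSpace ℝ (Fin 3) → ℝ :=
    fun τ s x => (-τ) * p τ ((Real.sqrt (-τ) / Real.sqrt (-s)) • x) with hQ_def
  have hQ : ∀ τ s x, Q τ s x = (-τ) * p τ ((Real.sqrt (-τ) / Real.sqrt (-s)) • x) := fun τ s x => rfl
  set Φ : ℝ → ℝ → ℝ := fun τ s => ∫ x, Q τ s x * G s x with hΦ_def
  set γ : ℝ → ℝ := fun τ =>
    ∫ x, (timeDerivWithin S (Q τ) τ x + fderiv ℝ (Q τ τ) x (v τ x) - (Δ (Q τ τ)) x) * G τ x with hγ_def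
  have hΦ' : ∀ τ ∈ S, HasDerivAt (Φ τ) (γ τ) τ := fun τ hτ =>
    hasDerivAt_frozenPairing hA hcl hK hC₁ hC₂ hup hb hKp0 hKp' hτ (hQ τ)
  -- the enstrophy pairing
  set H : ℝ → ℝ := fun t => ∫ x, ‖curl (v t) x‖ ^ 2 * G t x with hH_def
  have hHcont : ContinuousOn H S := continuousOn_enstrophyPairing hcl hK hC₁ hC₂ hup hb hL0 h1
  -- frozen window bounds, packaged
  have hfrozen : ∀ τ ∈ S, ∃ Mt : ℝ, ∀ s ∈ S, ∀ x, |Q τ s x| ≤ Mt ∧ ‖fderiv ℝ (Q τ s) x‖ ≤ Mt ∧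
      |(Δ (Q τ s)) x| ≤ Mt ∧ |timeDerivWithin S (Q τ) s x| ≤ Mt := by
    intro τ hτ
    have hτ0 : τ < 0 := hSI hτ
    have hbd := frozen_window_bounds le_rfl hb hτ (hcl.contDiff_pressure hτ0) hKp0 (fun z => (hKp' τ hτ0 z).1)
      (fun z => (hKp' τ hτ0 z).2.1) (fun z => (hKp' τ hτ0 z).2.2) (hQ τ)
    refine ⟨max (max (Kp / (-b)) (Kp / (-b) ^ 2)) (3 * Kp / (-b) ^ 3), fun s hs x => ?_⟩
    obtain ⟨e0, e1, e2, e3⟩ := hbd s hs x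
    exact ⟨e0.trans ((le_max_left _ _).trans (le_max_left _ _)),
      e1.trans ((le_max_right _ _).trans (le_max_left _ _)), e2.trans (le_max_right _ _),
      e3.trans ((le_max_right _ _).trans (le_max_left _ _))⟩
  -- the cancellation `a' + γ = −(−t) H`
  have hcancel : ∀ t ∈ S, a' t + γ t = -((-t) * H t) := by
    intro t ht
    obtain ⟨Mt, hMt⟩ := hfrozen t ht
    exact head_add_frozen_pairing hA hcl hK hb hqE hMEw ht (hQ t) hMt
  -- sizes: `|A| ≤ ME`, `|D| ≤ Kp`
  have hAbs : ∀ t ∈ S, |A t| ≤ ME := by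
    intro t ht
    have ht0 : t < 0 := hSI ht
    have hc : Continuous (qE t) := ((isSmoothSpaceTimeOn_headField (hcl.smooth_velocity.mono hSI) hqE).contDiff_slice
      ht).continuous
    exact abs_pairing_le hK (hSK ht) hc fun x => abs_headField_le hdec hD0 hqE ht0 x
  have hDbs : ∀ t ∈ S, |Φ t t| ≤ Kp := by
    intro t ht
    have ht0 : t < 0 := hSI ht
    have hc : Continuous (Q t t) :=
      (((isSmoothSpaceTimeOn_frozen (hcl.contDiff_pressure ht0) (hQ t)).mono hSI).contDiff_slice ht).continuous
    refine abs_pairing_le hK (hSK ht) hc fun x => ?_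
    rw [hQ, dil_self ht0, one_smul]
    exact abs_neg_mul_pressure_le ht0 (fun z => (hKp' t ht0 z).1) x
  -- (1) FTC for `A`
  have hFTC : ∫ t in t₁..t₂, a' t = A t₂ - A t₁ :=
    integral_eq_sub_of_hasDerivAt (fun t ht => hA' t (hIS (by rwa [uIcc_of_le ht₁₂] at ht)))
      ((ha'cont.mono hIS).intervalIntegrable_of_Icc ht₁₂)
  -- (2) the Dini inequality for the diagonal `D(t) = Φ t t`
  -- (2a) continuity of the diagonal
  have hDcont : ContinuousOn (fun t => Φ t t) (Icc t₁ t₂) := by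
    have hd : IsSmoothSpaceTimeOn S (fun t x => (-t) * p t x) := by
      show ContDiffOn ℝ ∞ (uncurry fun t x => (-t) * p t x) (S ×ˢ univ)
      have e : (uncurry fun t (x : EuclideanSpace ℝ (Fin 3)) => (-t) * p t x) =
          fun z : ℝ × EuclideanSpace ℝ (Fin 3) => (-z.1) * uncurry p z := by
        funext z; rcases z with ⟨t, x⟩; rfl
      rw [e]
      exact contDiffOn_fst.neg.mul (hcl.smooth_pressure.mono hSI)
    have hdb : ∀ t ∈ S, ∀ x, |(-t) * p t x| ≤ Kp := fun t ht x =>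
      abs_neg_mul_pressure_le (hSI ht) (fun z => (hKp' t (hSI ht) z).1) x
    have hc := continuousOn_pairing_window hK hC₁ hC₂ hup le_rfl hb hd hdb
    refine (hc.mono hIS).congr fun t ht => ?_
    have ht0 : t < 0 := hSI (hIS ht)
    show Φ t t = ∫ x, (-t) * p t x * G t x
    simp only [hΦ_def, hQ_def]
    refine integral_congr_ae (Eventually.of_forall fun x => ?_)
    beta_reduce
    rw [dil_self ht0, one_smul]
  -- (2b) the Dini bound
  have hdini : ∀ t ∈ Ico t₁ t₂, ∀ y : ℝ, γ t < y → ∀ᶠ u in 𝓝[>] t, Φ u u - Φ t t ≤ (u - t) * y := by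
    intro t ht y hy
    have htS : t ∈ S := hIS ⟨ht.1, ht.2.le⟩
    refine rightDini_of_le_of_hasDerivAt (hΦ' t htS) ?_ hy
    have hnb : Ioo t b ∈ 𝓝[>] t := Ioo_mem_nhdsGT htS.2
    filter_upwards [hnb] with u hu
    have huS : u ∈ S := ⟨lt_trans htS.1 hu.1, hu.2⟩
    have hu0 : u < 0 := hSI huS
    have huK := hSK huS
    -- `Φ u u ≤ Φ t u`: the frozen field is non-increasing in the frozen time
    have hGi : Integrable (G u) := hK.integrable huK
    have hGc : Continuous (G u) := (hK.contDiff_slice huK).continuous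
    have hint : ∀ τ ∈ S, Integrable fun x => Q τ u x * G u x := by
      intro τ hτ
      obtain ⟨Mt, hMt⟩ := hfrozen τ hτ
      have hc : Continuous (Q τ u) :=
        (((isSmoothSpaceTimeOn_frozen (hcl.contDiff_pressure (hSI hτ)) (hQ τ)).mono hSI).contDiff_slice huS).continuous
      exact integrable_mul_kernel hc (fun x => (hMt u huS x).1) hGi hGc
    have hle : Φ u u ≤ Φ t u := by
      refine integral_mono (hint u huS) (hint t htS) fun x => ?_
      exact mul_le_mul_of_nonneg_right (frozen_le_frozen hmono hu.1.le hu0 x) (hK.pos u huK x).le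
    linarith
  -- (2c) integrability of `γ` on the window: `γ = −(−t)H − a'` there
  have hγcont : ContinuousOn γ (Icc t₁ t₂) := by
    have hc : ContinuousOn (fun t => -((-t) * H t) - a' t) S :=
      ((continuousOn_id.neg.mul hHcont).neg).sub ha'cont
    refine (hc.mono hIS).congr fun t ht => ?_
    have := hcancel t (hIS ht)
    show γ t = -((-t) * H t) - a' t
    linarith
  have hDini : Φ t₂ t₂ - Φ t₁ t₁ ≤ ∫ t in t₁..t₂, γ t :=
    sub_le_integral_of_rightDini_le ht₁₂ hDcont hdini (hγcont.integrableOn_compact isCompact_Icc) fun t _ => le_rfl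
  -- (3) assembly
  have hHI : ContinuousOn (fun t => (-t) * H t) (Icc t₁ t₂) := (continuousOn_id.neg.mul (hHcont.mono hIS))
  have hHint : IntervalIntegrable (fun t => (-t) * H t) volume t₁ t₂ := hHI.intervalIntegrable_of_Icc ht₁₂
  have ha'int : IntervalIntegrable a' volume t₁ t₂ := (ha'cont.mono hIS).intervalIntegrable_of_Icc ht₁₂
  have hγint : IntervalIntegrable γ volume t₁ t₂ := hγcont.intervalIntegrable_of_Icc ht₁₂
  refine ⟨hHint, ?_⟩
  have heq : ∫ t in t₁..t₂, (-t) * H t = -(∫ t in t₁..t₂, a' t) - ∫ t in t₁..t₂, γ t := by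
    have e1 : ∫ t in t₁..t₂, (-t) * H t = ∫ t in t₁..t₂, (-(a' t) - γ t) := by
      refine intervalIntegral.integral_congr fun t ht => ?_
      rw [uIcc_of_le ht₁₂] at ht
      have := hcancel t (hIS ht)
      show (-t) * H t = -(a' t) - γ t
      linarith
    rw [e1, intervalIntegral.integral_sub (f := fun t => -(a' t)) (g := γ) ha'int.neg hγint,
      intervalIntegral.integral_neg]
  have hA₁ := hAbs t₁ (hIS (left_mem_Icc.2 ht₁₂))
  have hA₂ := hAbs t₂ (hIS (right_mem_Icc.2 ht₁₂))
  have hD₁ := hDbs t₁ (hIS (left_mem_Icc.2 ht₁₂))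
  have hD₂ := hDbs t₂ (hIS (right_mem_Icc.2 ht₁₂))
  rw [heq, hFTC]
  have e1 : -(A t₂ - A t₁) ≤ |A t₁| + |A t₂| := by
    have := neg_abs_le (A t₁); have := le_abs_self (A t₁); have := neg_abs_le (A t₂); linarith
  have e2 : -(∫ t in t₁..t₂, γ t) ≤ |Φ t₁ t₁| + |Φ t₂ t₂| := by
    have := le_abs_self (Φ t₁ t₁); have := neg_abs_le (Φ t₂ t₂); linarith
  linarith

end Summit.NavierStokesRegularity.NavierStokesRegularity.Theorems.LocalPressureProfileDoorMonotonePressureProfileRigiditySmallSliceBudget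

end
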